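import Literature.NumberTheory.LFunctions.LiouvilleOneSided
import Literature.NumberTheory.LFunctions.GeneralizedRH
import Literature.NumberTheory.LFunctions.ZetaRealAxis
import HarnessLib

/-!
# One-sided bounds on `L(x) = ∑_{n ≤ x} λ(n)`: the Riemann hypothesis (Pólya 1919, Ingham 1942) and `lim inf L(x)/√x ≤ 1/ζ(1/2)`

Topic `Literature/NumberTheory/LFunctions`. Consequences of the Landau step for Pólya's sum
`L(x)` (the tree's `liouvilleSum`) proved in `LiouvilleOneSided.lean`
(`integrableOn_liouville_rpow_of_oneSided`: a one-sided bound `η L(x) ≤ A√x` makes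
`∫_1^∞ |L(x)| x^{-σ-1} dx` converge for every `σ > ½`; `riemannZeta_ne_zero_of_liouville_integrable`,
`mellin_liouville_eq_of_integrable`: then `ζ ≠ 0` on `Re s > ½` and
`∫_1^∞ L(x) x^{-s-1} dx = ζ(2s)/(sζ(s))` there).

Borwein–Ferguson–Mossinghoff 2008, §1 (p. 1681): "Pólya noted in 1919 that the Riemann hypothesis
follows if `L(n)` does not change sign for sufficiently large `n`. This may be established by
applying partial summation in (1) and then employing a well-known theorem of Landau on the
convergence of Dirichlet series with terms of constant sign"; (p. 1682): "In 1942, Ingham noted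
that the Riemann hypothesis, and the simplicity of the zeros of `ζ(s)` follow more generally if
either `L(n) < c√n` or `L(n) > −c√n`, for some positive constant `c`." Bateman–Diamond §11.5.1:
"`s ∫_1^∞ x^{-s-1} L(x) dx = ζ(2s)/ζ(s) (σ > 1)` … If Pólya's conjecture were true, then by Landau's
theorem, the last representation would hold … and the R.H. would be true." Montgomery–Vaughan
§15.1.1, Exercise 8 "(Ingham 1942; cf. Haselgrove 1958) (b) Show that
`lim inf_{x→∞} L(x)/x^{1/2} ≤ 1/ζ(1/2) (= −0.685…)`."

## Main results (all proved, sorry-free, axioms `propext`/`Classical.choice`/`Quot.sound`)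

* `riemannHypothesis_of_liouvilleSum_oneSided` — **Pólya 1919 / Ingham 1942 (RH part)**: a
  one-sided bound `η L(x) ≤ A√x` for `x ≥ x₁` (`η = ±1`) implies Mathlib's `RiemannHypothesis`
  (no zeros on `Re s > ½` by Landau, none on `0 < Re s < ½` by the functional equation, strip form
  `riemannHypothesis_iff_strip_holds`); `riemannHypothesis_of_liouvilleSum_eventually_nonpos`,
  `riemannHypothesis_of_liouvilleSum_eventually_nonneg` — the two cases of "`L(n)` does not change
  sign for sufficiently large `n`".
* `neg_inv_riemannZeta_half_le_of_liouvilleSum_ge` — the one-sided Landau argument at the pole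
  `s = ½` of `ζ(2s)`: if `L(x) ≥ −c√x` for all large `x` then `c ≥ −1/ζ(½)`; whence
  `frequently_liouvilleSum_lt_mul_sqrt` — **MV Exercise 15.1.1.8 (b)**: for every `κ > 1/ζ(½)`,
  `L(x) < κ√x` for arbitrarily large `x` (`lim inf L(x)/√x ≤ 1/ζ(½)`), and, as `ζ(½) < 0`
  (Titchmarsh §2.12, the tree's `riemannZeta_neg_of_pos_of_lt_one`), `frequently_liouvilleSum_neg`,
  `frequently_liouvilleSum_natCast_neg`, `not_eventually_liouvilleSum_natCast_nonneg`: `L(x) < 0`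
  for arbitrarily large (integer) `x` — the elementary half of Haselgrove's theorem "`L(x)` changes
  sign infinitely often" (BFM §1, p. 1683). The other half (`L(x) > 0` infinitely often) is
  Haselgrove's numerical application of Ingham's kernel method and is not proved here.

## References

* [BorweinFergusonMossinghoff2008] P. Borwein, R. Ferguson, M. J. Mossinghoff, Sign changes in sums
  of the Liouville function, Math. Comp. 77 (2008), 1681–1694: §1, pp. 1681–1683.
* [BatemanDiamond2004] P. T. Bateman, H. G. Diamond, Analytic Number Theory: An Introductory
  Course, World Scientific 2004: §11.5.1 (Applications: Pólya's conjecture and Landau's theorem).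
* [MontgomeryVaughan2007] H. L. Montgomery, R. C. Vaughan, Multiplicative Number Theory I, CUP
  2007: §15.1 Lemma 15.1 (Landau); §15.1.1 Exercise 8 (b).
* [Titchmarsh1986] E. C. Titchmarsh, The Theory of the Riemann Zeta-Function, 2nd ed.: §2.1
  (2.1.4); §2.12 (`ζ(σ) < 0` on `0 < σ < 1`).
-/

noncomputable section

open Complex Filter Asymptotics MeasureTheory Set
open scoped Real Topology

namespace Literature.NumberTheory.LFunctions

/-- `L(⌊x⌋) = L(x)` (a step function). [folklore] -/
theorem liouvilleSum_natFloor (x : ℝ) : liouvilleSum (⌊x⌋₊ : ℕ) = liouvilleSum x := by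
  unfold liouvilleSum
  rw [Nat.floor_natCast]

/-! ## RH from a one-sided bound (Pólya 1919; Ingham 1942) -/

/-- **A one-sided bound `η L(x) ≤ A√x` implies the Riemann hypothesis** (Pólya 1919 for `A = 0`:
"the Riemann hypothesis follows if `L(n)` does not change sign for sufficiently large `n`";
Ingham 1942: "the Riemann hypothesis … follow[s] more generally if either `L(n) < c√n` or
`L(n) > −c√n`", BFM §1 pp. 1681–1682): no zeros on `Re s > ½` by Landau's theorem
(`riemannZeta_ne_zero_of_liouville_integrable`, `LiouvilleOneSided.lean`), none on `0 < Re s < ½` by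
the functional equation (`riemannZeta_one_sub`), and the strip form is Mathlib's `RiemannHypothesis`
(`riemannHypothesis_iff_strip_holds`). [cite: BorweinFergusonMossinghoff2008, §1 (pp. 1681–1682)]
[cite: BatemanDiamond2004, §11.5.1 (Applications)] -/
theorem riemannHypothesis_of_liouvilleSum_oneSided {A x₁ η : ℝ} (hη : η = 1 ∨ η = -1)
    (hb : ∀ x, x₁ ≤ x → η * (liouvilleSum x : ℝ) ≤ A * Real.sqrt x) : RiemannHypothesis := by
  have hI : ∀ σ : ℝ, 1 / 2 < σ →
      IntegrableOn (fun x ↦ (liouvilleSum x : ℝ) * x ^ (-(σ + 1))) (Ioi 1) :=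
    fun σ hσ ↦ integrableOn_liouville_rpow_of_oneSided hη hb hσ
  have hright : ∀ s : ℂ, 1 / 2 < s.re → riemannZeta s ≠ 0 :=
    fun s hs ↦ riemannZeta_ne_zero_of_liouville_integrable hI hs
  have e : RiemannHypothesis ↔ RiemannHypothesisStrip := riemannHypothesis_iff_strip_holds
  refine e.2 fun ρ hζ h0 h1 ↦ ?_
  rcases lt_trichotomy ρ.re (1 / 2) with h | h | h
  · exfalso
    have hρn : ∀ n : ℕ, ρ ≠ -n := by
      intro n hn
      have := congrArg Complex.re hn
      simp at this
      linarith
    have hρ1 : ρ ≠ 1 := by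
      intro h1'
      rw [h1'] at h1
      simp at h1
    have h1ρ : riemannZeta (1 - ρ) = 0 := by
      rw [riemannZeta_one_sub hρn hρ1, hζ, mul_zero]
    exact hright (1 - ρ) (by simp; linarith) h1ρ
  · exact h
  · exact absurd hζ (hright ρ h)

/-- Pólya's 1919 remark, case "eventually `L(x) ≤ 0`" (real `x ≥ x₁`): RH follows.
[cite: BorweinFergusonMossinghoff2008, §1 (p. 1681)] [cite: BatemanDiamond2004, §11.5.1 (Applications)] -/
theorem riemannHypothesis_of_liouvilleSum_eventually_nonpos {x₁ : ℝ}
    (h : ∀ x, x₁ ≤ x → liouvilleSum x ≤ 0) : RiemannHypothesis := by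
  refine riemannHypothesis_of_liouvilleSum_oneSided (A := 0) (η := 1) (x₁ := x₁) (Or.inl rfl)
    fun x hx ↦ ?_
  have : (liouvilleSum x : ℝ) ≤ 0 := by exact_mod_cast h x hx
  simpa using this

/-- Pólya's 1919 remark, case "eventually `L(x) ≥ 0`" (real `x ≥ x₁`): RH follows (this case is in
fact void, `frequently_liouvilleSum_neg`). [cite: BorweinFergusonMossinghoff2008, §1 (p. 1681)] -/
theorem riemannHypothesis_of_liouvilleSum_eventually_nonneg {x₁ : ℝ}
    (h : ∀ x, x₁ ≤ x → 0 ≤ liouvilleSum x) : RiemannHypothesis := by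
  refine riemannHypothesis_of_liouvilleSum_oneSided (A := 0) (η := -1) (x₁ := x₁) (Or.inr rfl)
    fun x hx ↦ ?_
  have : (0 : ℝ) ≤ (liouvilleSum x : ℝ) := by exact_mod_cast h x hx
  simpa using this

/-! ## `lim inf L(x)/√x ≤ 1/ζ(1/2)`: the pole of `ζ(2s)` at `s = ½` -/

/-- Lower bound for the real Mellin integral of a function that is `≥ 0` beyond `x₁ ≥ 1` and
bounded by `C x` in absolute value: `∫_1^∞ g(x) x^{-σ-1} dx ≥ -C x₁/σ` (`σ > 0`). [folklore] -/
theorem setIntegral_rpow_ge_of_nonneg_beyond {g : ℝ → ℝ} {C x₁ σ : ℝ} (hC : 0 ≤ C) (hx₁ : 1 ≤ x₁)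
    (hσ : 0 < σ) (habs : ∀ x, 1 < x → |g x| ≤ C * x) (hpos : ∀ x, x₁ ≤ x → 0 ≤ g x)
    (hI : IntegrableOn (fun x ↦ g x * x ^ (-(σ + 1))) (Ioi 1)) :
    -(C * x₁ / σ) ≤ ∫ x in Ioi (1 : ℝ), g x * x ^ (-(σ + 1)) := by
  have hlow : IntegrableOn (fun x : ℝ ↦ -(C * x₁ * x ^ (-(σ + 1)))) (Ioi 1) :=
    ((integrableOn_Ioi_rpow_of_lt (by linarith : -(σ + 1) < -1) zero_lt_one).const_mul
      (C * x₁)).neg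
  have hle : ∀ x ∈ Ioi (1 : ℝ), -(C * x₁ * x ^ (-(σ + 1))) ≤ g x * x ^ (-(σ + 1)) := by
    intro x hx
    have hx1 : 1 < x := hx
    have hx0 : 0 < x := by linarith
    have hxpow : 0 < x ^ (-(σ + 1)) := Real.rpow_pos_of_pos hx0 _
    rcases le_or_gt x₁ x with h | h
    · have h1 := mul_nonneg (hpos x h) hxpow.le
      have h2 := mul_nonneg (mul_nonneg hC (by linarith : (0 : ℝ) ≤ x₁)) hxpow.le
      linarith
    · have h1 : -(C * x₁) ≤ g x := by
        have ha := habs x hx1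
        have hb := neg_abs_le (g x)
        have hc : C * x ≤ C * x₁ := mul_le_mul_of_nonneg_left h.le hC
        linarith
      have := mul_le_mul_of_nonneg_right h1 hxpow.le
      linarith
  calc -(C * x₁ / σ) = ∫ x in Ioi (1 : ℝ), -(C * x₁ * x ^ (-(σ + 1))) := by
        rw [integral_neg, integral_const_mul, integral_Ioi_rpow_of_lt (by linarith) zero_lt_one,
          Real.one_rpow]
        have hσ1 : -(σ + 1) + 1 = -σ := by ring
        rw [hσ1]
        field_simp
    _ ≤ ∫ x in Ioi (1 : ℝ), g x * x ^ (-(σ + 1)) :=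
        setIntegral_mono_on hlow hI measurableSet_Ioi hle

/-- For real `σ > 0`, `σ ≠ 1`: `1/(σ-1) ≤ ζ(σ) ≤ σ/(σ-1)` (Titchmarsh (2.1.4) on the real axis,
`ζ(σ) = σ/(σ-1) - σ ∫_1^∞ {x} x^{-σ-1} dx` with `0 ≤ ∫_1^∞ {x} x^{-σ-1} dx ≤ 1/σ`).
[cite: Titchmarsh1986, §2.1 eq. (2.1.4)] -/
theorem riemannZeta_ofReal_re_mem_Icc {σ : ℝ} (h0 : 0 < σ) (h1 : σ ≠ 1) :
    (riemannZeta σ).re ∈ Icc (1 / (σ - 1)) (σ / (σ - 1)) := by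
  set F : ℝ := ∫ x in Ioi (1 : ℝ), Int.fract x * x ^ (-(σ + 1)) with hF
  have hζ : (riemannZeta σ).re = σ / (σ - 1) - σ * F := by
    rw [riemannZeta_ofReal_eq_of_pos h0 h1, ofReal_re]
  have hF0 : 0 ≤ F := fractIntegralReal_nonneg σ
  have hF1 : F ≤ 1 / σ := by
    have h := norm_fractIntegral_le (s := (σ : ℂ)) (by simpa using h0)
    rwa [fractIntegral_ofReal, Complex.norm_real, Real.norm_eq_abs, abs_of_nonneg hF0,
      ofReal_re] at h
  have hσF : σ * F ≤ 1 := by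
    calc σ * F ≤ σ * (1 / σ) := mul_le_mul_of_nonneg_left hF1 h0.le
      _ = 1 := by field_simp
  refine ⟨?_, ?_⟩
  · rw [hζ]
    have hne : σ - 1 ≠ 0 := sub_ne_zero.2 h1
    have : 1 / (σ - 1) = σ / (σ - 1) - 1 := by rw [div_sub_one hne, sub_sub_cancel]
    rw [this]
    linarith
  · rw [hζ]
    have := mul_nonneg h0.le hF0
    linarith

/-- **The one-sided Landau argument at the pole `s = ½`** (Ingham 1942; Montgomery–Vaughan
§15.1.1 Exercise 8 (b)): if `L(x) ≥ -c√x` for all `x ≥ x₁`, then `c ≥ -1/ζ(½)` (`= 0.685…`). Proof: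
`g = c√x + L ≥ 0` beyond `x₁`, so by Landau (`integrableOn_liouville_rpow_of_oneSided`) and
analytic continuation (`mellin_liouville_eq_of_integrable`)
`∫_1^∞ g x^{-σ-1} dx = c/(σ-½) + ζ(2σ)/(σζ(σ))` for real `½ < σ < 1`; the left side is `≥ -C`
uniformly in `σ`, while `ζ(2σ) ≥ 1/(2σ-1)` and `ζ(σ) < 0` bound the right side by
`(c + 1/(2σζ(σ)))/(σ-½)`, which tends to `-∞` as `σ → ½⁺` if `c + 1/ζ(½) < 0`.
[cite: MontgomeryVaughan2007, §15.1.1 Exercise 8 (b)] [cite: BorweinFergusonMossinghoff2008, §1 (p. 1682)] -/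
theorem neg_inv_riemannZeta_half_le_of_liouvilleSum_ge {c x₁ : ℝ}
    (hb : ∀ x, x₁ ≤ x → -(c * Real.sqrt x) ≤ (liouvilleSum x : ℝ)) :
    -(1 / (riemannZeta (1 / 2)).re) ≤ c := by
  -- normalise `x₁ ≥ 1`
  set x₂ : ℝ := max x₁ 1 with hx₂
  have hx₂1 : 1 ≤ x₂ := le_max_right _ _
  have hb₂ : ∀ x, x₂ ≤ x → -(c * Real.sqrt x) ≤ (liouvilleSum x : ℝ) :=
    fun x hx ↦ hb x ((le_max_left _ _).trans hx)
  -- the one-sided bound in the form `η L ≤ A √x` with `η = -1`, `A = c`, and Landau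
  have hb' : ∀ x, x₂ ≤ x → (-1) * (liouvilleSum x : ℝ) ≤ c * Real.sqrt x := by
    intro x hx; have := hb₂ x hx; linarith
  have hI : ∀ σ : ℝ, 1 / 2 < σ →
      IntegrableOn (fun x ↦ (liouvilleSum x : ℝ) * x ^ (-(σ + 1))) (Ioi 1) :=
    fun σ hσ ↦ integrableOn_liouville_rpow_of_oneSided (Or.inr rfl) hb' hσ
  -- `ζ(1/2) < 0`
  have hζhalf : (riemannZeta (1 / 2)).re < 0 := by
    have := riemannZeta_re_neg_of_pos_of_lt_one (σ := 1 / 2) (by norm_num) (by norm_num)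
    push_cast at this
    exact this
  -- the key inequality for every real `½ < σ < 1`:
  --   `-(|c|+1) x₂/σ ≤ ∫ (c√x + L) x^{-σ-1} = c/(σ-½) + ζ(2σ)/(σ ζ(σ)) ≤ (c + 1/(2σ ζ(σ)))/(σ - ½)`
  have key : ∀ σ : ℝ, 1 / 2 < σ → σ < 1 →
      -((|c| + 1) * x₂ / σ) ≤ (c + 1 / (2 * σ * (riemannZeta σ).re)) / (σ - 1 / 2) := by
    intro σ hσ hσ1
    have hσ0 : 0 < σ := by linarith
    -- the function `g = c √x + L`
    set g : ℝ → ℝ := fun x ↦ c * Real.sqrt x + (liouvilleSum x : ℝ) with hg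
    have hgI : IntegrableOn (fun x ↦ g x * x ^ (-(σ + 1))) (Ioi 1) := by
      have : (fun x ↦ g x * x ^ (-(σ + 1))) =
          fun x ↦ c * (Real.sqrt x * x ^ (-(σ + 1))) + (liouvilleSum x : ℝ) * x ^ (-(σ + 1)) := by
        funext x; simp only [hg]; ring
      rw [this]
      exact ((integrableOn_sqrt_mul_rpow hσ).const_mul c).add (hI σ hσ)
    -- lower bound for the real integral of `g`
    have hlow : -((|c| + 1) * x₂ / σ) ≤ ∫ x in Ioi (1 : ℝ), g x * x ^ (-(σ + 1)) := by
      refine setIntegral_rpow_ge_of_nonneg_beyond (by positivity) hx₂1 hσ0 ?_ ?_ hgI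
      · intro x hx
        have hx0 : 0 < x := by linarith
        have hsx : Real.sqrt x ≤ x := by
          have h1 : 1 ≤ Real.sqrt x := Real.one_le_sqrt.mpr hx.le
          nlinarith [Real.mul_self_sqrt hx0.le, Real.sqrt_nonneg x]
        simp only [hg]
        calc |c * Real.sqrt x + (liouvilleSum x : ℝ)|
            ≤ |c * Real.sqrt x| + |(liouvilleSum x : ℝ)| := abs_add_le _ _
          _ = |c| * Real.sqrt x + |(liouvilleSum x : ℝ)| := by
              rw [abs_mul, abs_of_nonneg (Real.sqrt_nonneg x)]
          _ ≤ |c| * x + x := add_le_add (mul_le_mul_of_nonneg_left hsx (abs_nonneg c))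
              (abs_liouvilleSum_le hx0.le)
          _ = (|c| + 1) * x := by ring
      · intro x hx
        simp only [hg]
        have := hb₂ x hx
        linarith
    -- the value of the integral: `c/(σ-½) + ζ(2σ)/(σζ(σ))`
    have hσ1' : (σ : ℂ) ≠ 1 := by exact_mod_cast hσ1.ne
    have hmel := mellin_liouville_eq_of_integrable hI (s := (σ : ℂ)) (by simpa using hσ) hσ1'
    have hsqrt := integral_sqrt_mul_cpow (s := (σ : ℂ)) (by simpa using hσ)
    have hgC : (((∫ x in Ioi (1 : ℝ), g x * x ^ (-(σ + 1)) : ℝ)) : ℂ) =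
        (c : ℂ) * (1 / ((σ : ℂ) - 1 / 2)) + riemannZeta (2 * σ) / ((σ : ℂ) * riemannZeta σ) := by
      have h1 : (((∫ x in Ioi (1 : ℝ), g x * x ^ (-(σ + 1)) : ℝ)) : ℂ) =
          Landau.mellinIoi g (σ : ℂ) := by
        rw [← Landau.mellinIoiLog_zero, Landau.mellinIoiLog_ofReal]
        simp
      rw [h1]
      unfold Landau.mellinIoi at hmel ⊢
      have hsplit : ∀ x : ℝ, ((g x : ℝ) : ℂ) * (x : ℂ) ^ (-((σ : ℂ) + 1)) =
          (c : ℂ) * (((Real.sqrt x : ℝ) : ℂ) * (x : ℂ) ^ (-((σ : ℂ) + 1))) +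
            ((((liouvilleSum x : ℝ)) : ℂ) * (x : ℂ) ^ (-((σ : ℂ) + 1))) := by
        intro x; simp only [hg]; push_cast; ring
      simp_rw [hsplit]
      have hσ1re : 1 / 2 < ((σ : ℂ)).re := by simpa using hσ
      rw [integral_add ((integrableOn_sqrt_mul_cpow hσ1re).const_mul _) ?_, integral_const_mul,
        hsqrt, hmel]
      -- integrability of the complex `L`-integrand at `σ` (from `hI`)
      have hIσ := hI σ hσ
      have : (fun x : ℝ ↦ (((liouvilleSum x : ℝ)) : ℂ) * (x : ℂ) ^ (-((σ : ℂ) + 1)))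
          =ᵐ[volume.restrict (Ioi 1)]
          fun x : ℝ ↦ ((((liouvilleSum x : ℝ)) * x ^ (-(σ + 1)) : ℝ) : ℂ) := by
        rw [Filter.EventuallyEq, ae_restrict_iff' measurableSet_Ioi]
        refine Eventually.of_forall fun x (hx : 1 < x) ↦ ?_
        have hx0 : 0 ≤ x := by linarith
        rw [Complex.ofReal_mul, Complex.ofReal_cpow hx0]
        congr 2
        push_cast
        ring
      exact (hIσ.ofReal).congr this.symm
    -- real forms of `ζ(σ)`, `ζ(2σ)`
    have hζσ_im : (riemannZeta σ).im = 0 := riemannZeta_im_eq_zero_of_pos hσ0 hσ1.ne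
    have hζ2σ_im : (riemannZeta (2 * σ)).im = 0 := by
      have := riemannZeta_im_eq_zero_of_pos (σ := 2 * σ) (by linarith) (by linarith)
      push_cast at this
      exact this
    have hζσ_eq : riemannZeta σ = ((riemannZeta σ).re : ℂ) :=
      Complex.ext (by simp) (by simp [hζσ_im])
    have hζ2σ_eq : riemannZeta (2 * σ) = ((riemannZeta (2 * σ)).re : ℂ) :=
      Complex.ext (by simp) (by simp [hζ2σ_im])
    set z1 : ℝ := (riemannZeta σ).re with hz1
    set z2 : ℝ := (riemannZeta (2 * σ)).re with hz2
    -- signs and sizes: `z1 < 0`, `z2 ≥ 1/(2σ-1) > 0`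
    have hz1_neg : z1 < 0 := riemannZeta_re_neg_of_pos_of_lt_one hσ0 hσ1
    have hz2_ge : 1 / (2 * σ - 1) ≤ z2 := by
      have h := (riemannZeta_ofReal_re_mem_Icc (σ := 2 * σ) (by linarith) (by linarith)).1
      push_cast at h
      exact h
    have h2σ1 : 0 < 2 * σ - 1 := by linarith
    -- the real identity `∫ g x^{-σ-1} = c/(σ-½) + z2/(σ z1)`
    have hIreal : (∫ x in Ioi (1 : ℝ), g x * x ^ (-(σ + 1))) =
        c * (1 / (σ - 1 / 2)) + z2 / (σ * z1) := by
      have h := hgC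
      rw [hζσ_eq, hζ2σ_eq] at h
      have h' : (((∫ x in Ioi (1 : ℝ), g x * x ^ (-(σ + 1)) : ℝ)) : ℂ) =
          ((c * (1 / (σ - 1 / 2)) + z2 / (σ * z1) : ℝ) : ℂ) := by
        rw [h]; push_cast; ring
      exact Complex.ofReal_injective h'
    -- drop the part `z2 - 1/(2σ-1) ≥ 0` (it is divided by `σ z1 < 0`)
    have hσz1 : σ * z1 < 0 := mul_neg_of_pos_of_neg hσ0 hz1_neg
    have hdrop : z2 / (σ * z1) ≤ (1 / (2 * σ - 1)) / (σ * z1) :=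
      div_le_div_of_nonpos_of_le hσz1.le hz2_ge
    have hrewrite : c * (1 / (σ - 1 / 2)) + (1 / (2 * σ - 1)) / (σ * z1) =
        (c + 1 / (2 * σ * z1)) / (σ - 1 / 2) := by
      have hA : (1 / (2 * σ - 1)) / (σ * z1) = (1 / (2 * σ * z1)) / (σ - 1 / 2) := by
        rw [div_div, div_div, one_div, one_div, inv_inj]
        ring
      rw [hA, add_div, mul_one_div]
    calc -((|c| + 1) * x₂ / σ) ≤ ∫ x in Ioi (1 : ℝ), g x * x ^ (-(σ + 1)) := hlow
      _ = c * (1 / (σ - 1 / 2)) + z2 / (σ * z1) := hIreal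
      _ ≤ c * (1 / (σ - 1 / 2)) + (1 / (2 * σ - 1)) / (σ * z1) := by linarith
      _ = (c + 1 / (2 * σ * z1)) / (σ - 1 / 2) := hrewrite
  -- suppose `c < -1/ζ(1/2)`; continuity of `σ ↦ c + 1/(2σζ(σ))` at `½` (value `c + 1/ζ(½) < 0`)
  by_contra hc
  rw [not_le] at hc
  set κ : ℝ := -(c + 1 / (riemannZeta (1 / 2)).re) with hκ
  have hκ0 : 0 < κ := by rw [hκ]; linarith
  have hcont : ContinuousAt (fun σ : ℝ ↦ (riemannZeta σ).re) (1 / 2) := by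
    have h1 : ContinuousAt riemannZeta ((1 / 2 : ℝ) : ℂ) :=
      (differentiableAt_riemannZeta (by norm_num)).continuousAt
    exact Complex.continuous_re.continuousAt.comp (h1.comp Complex.continuous_ofReal.continuousAt)
  have hne0 : (2 : ℝ) * (1 / 2) * (riemannZeta ((1 / 2 : ℝ) : ℂ)).re ≠ 0 := by
    have : (2 : ℝ) * (1 / 2) * (riemannZeta ((1 / 2 : ℝ) : ℂ)).re = (riemannZeta (1 / 2)).re := by
      push_cast; ring
    rw [this]
    exact hζhalf.ne
  have hcont2 : ContinuousAt (fun σ : ℝ ↦ c + 1 / (2 * σ * (riemannZeta σ).re)) (1 / 2) :=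
    continuousAt_const.add
      (continuousAt_const.div₀ ((continuousAt_const.mul continuousAt_id).mul hcont) hne0)
  have hval : c + 1 / (2 * (1 / 2) * (riemannZeta ((1 / 2 : ℝ) : ℂ)).re) = -κ := by
    rw [hκ]; push_cast; ring
  obtain ⟨δ₁, hδ₁, hδ₁b⟩ := Metric.continuousAt_iff.1 hcont2 (κ / 2) (by positivity)
  -- the uniform lower bound constant
  set B : ℝ := 2 * ((|c| + 1) * x₂) with hB
  have hB0 : 0 ≤ B := by positivity
  -- choose `σ = ½ + t` close to `½`
  set t : ℝ := min (δ₁ / 2) (min (1 / 4) (κ / (4 * (B + 1)))) with ht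
  have ht0 : 0 < t := lt_min (by positivity) (lt_min (by norm_num) (by positivity))
  have htδ : t < δ₁ := (min_le_left _ _).trans_lt (by linarith)
  have ht4 : t ≤ 1 / 4 := (min_le_right _ _).trans (min_le_left _ _)
  have htκ : t ≤ κ / (4 * (B + 1)) := (min_le_right _ _).trans (min_le_right _ _)
  set σ : ℝ := 1 / 2 + t with hσt
  have hσ : 1 / 2 < σ := by rw [hσt]; linarith
  have hσ1 : σ < 1 := by rw [hσt]; linarith
  have hσ0 : 0 < σ := by linarith
  -- continuity estimate at `σ`
  have hnear : c + 1 / (2 * σ * (riemannZeta σ).re) < -κ / 2 := by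
    have hd : dist σ (1 / 2) < δ₁ := by
      rw [Real.dist_eq, hσt, show 1 / 2 + t - 1 / 2 = t by ring, abs_of_pos ht0]
      exact htδ
    have h := hδ₁b hd
    rw [hval, Real.dist_eq, abs_lt] at h
    linarith [h.2]
  -- combine with `key`
  have hk := key σ hσ hσ1
  have hσhalf : σ - 1 / 2 = t := by rw [hσt]; ring
  rw [hσhalf] at hk
  have h1 : -B ≤ -((|c| + 1) * x₂ / σ) := by
    rw [hB, neg_le_neg_iff, div_le_iff₀ hσ0]
    have : 0 ≤ (|c| + 1) * x₂ := by positivity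
    nlinarith
  have h2 : (c + 1 / (2 * σ * (riemannZeta σ).re)) / t < (-κ / 2) / t :=
    div_lt_div_of_pos_right hnear ht0
  have h3 : (-κ / 2) / t ≤ -(2 * (B + 1)) := by
    rw [div_le_iff₀ ht0]
    have : t * (4 * (B + 1)) ≤ κ := by
      have := mul_le_mul_of_nonneg_right htκ (by positivity : (0 : ℝ) ≤ 4 * (B + 1))
      rwa [div_mul_cancel₀ _ (by positivity : (4 : ℝ) * (B + 1) ≠ 0)] at this
    nlinarith
  linarith

/-- **`lim inf_{x→∞} L(x)/√x ≤ 1/ζ(1/2)`** (Montgomery–Vaughan §15.1.1, Exercise 8 (Ingham 1942;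
cf. Haselgrove 1958) (b)), in the form: for every `κ > 1/ζ(1/2) (= −0.685…)`, `L(x) < κ√x` for
arbitrarily large `x`. [cite: MontgomeryVaughan2007, §15.1.1 Exercise 8 (b)] -/
theorem frequently_liouvilleSum_lt_mul_sqrt {κ : ℝ} (hκ : 1 / (riemannZeta (1 / 2)).re < κ) :
    ∃ᶠ x : ℝ in atTop, (liouvilleSum x : ℝ) < κ * Real.sqrt x := by
  by_contra h
  rw [Filter.not_frequently] at h
  simp only [not_lt] at h
  obtain ⟨x₁, hx₁⟩ := Filter.eventually_atTop.1 h
  have := neg_inv_riemannZeta_half_le_of_liouvilleSum_ge (c := -κ) (x₁ := x₁) fun x hx ↦ by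
    have := hx₁ x hx; linarith
  linarith

/-- **`L(x) < 0` for arbitrarily large `x`** — the elementary half of Haselgrove's theorem
"`L(x)` changes sign infinitely often" (BFM §1, p. 1683), from `lim inf L(x)/√x ≤ 1/ζ(1/2) < 0`
(Titchmarsh §2.12: `ζ(σ) < 0` on `(0,1)`). [cite: MontgomeryVaughan2007, §15.1.1 Exercise 8 (b)]
[cite: BorweinFergusonMossinghoff2008, §1 (p. 1683)] [cite: Titchmarsh1986, §2.12] -/
theorem frequently_liouvilleSum_neg : ∃ᶠ x : ℝ in atTop, liouvilleSum x < 0 := by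
  have hζhalf : (riemannZeta (1 / 2)).re < 0 := by
    have := riemannZeta_re_neg_of_pos_of_lt_one (σ := 1 / 2) (by norm_num) (by norm_num)
    push_cast at this
    exact this
  have h := frequently_liouvilleSum_lt_mul_sqrt (κ := 0) (by
    rw [one_div]; exact inv_lt_zero.2 hζhalf)
  refine h.mono fun x hx ↦ ?_
  rw [zero_mul] at hx
  exact_mod_cast hx

/-- The same along the integers: `L(n) < 0` for arbitrarily large `n : ℕ` (`L(x) = L(⌊x⌋)`).
[cite: MontgomeryVaughan2007, §15.1.1 Exercise 8 (b)] [cite: BorweinFergusonMossinghoff2008, §1 (p. 1683)] -/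
theorem frequently_liouvilleSum_natCast_neg : ∃ᶠ n : ℕ in atTop, liouvilleSum n < 0 := by
  rw [Filter.frequently_atTop]
  intro N
  obtain ⟨x, hx, hNx⟩ :=
    (frequently_liouvilleSum_neg.and_eventually (eventually_ge_atTop (N : ℝ))).exists
  refine ⟨⌊x⌋₊, Nat.le_floor hNx, ?_⟩
  rw [liouvilleSum_natFloor]
  exact hx

/-- Consequently `L(n)` is **not** eventually `≥ 0` along the integers (so "`L(n)` does not change
sign for sufficiently large `n`" can only mean "eventually `L(n) ≤ 0`", which is Haselgrove's to
refute). [cite: MontgomeryVaughan2007, §15.1.1 Exercise 8 (b)] -/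
theorem not_eventually_liouvilleSum_natCast_nonneg :
    ¬ ∃ N : ℕ, ∀ n : ℕ, N ≤ n → 0 ≤ liouvilleSum n := by
  rintro ⟨N, hN⟩
  obtain ⟨n, hn, hNn⟩ :=
    (frequently_liouvilleSum_natCast_neg.and_eventually (eventually_ge_atTop N)).exists
  exact absurd (hN n hNn) (not_le.2 hn)

end Literature.NumberTheory.LFunctions
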